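import Summits.BirchSwinnertonDyer.BirchSwinnertonDyer.Theorems.EisensteinPrimesAnalyticLambdaCruxSized
import Summits.BirchSwinnertonDyer.Rank1Residual.X1.TamagawaSqueeze
import HarnessLib

/-!
# Route `EisensteinPrimes`, crux 5 `MazurMCOnX1RankZero` (stmt-BirchSwinnertonDyer-19035), line
# `mudescent`, stub `stub_lambdaCount_offLocus` in the X1 (good ordinary) currency — the ANALYTIC
# conjunct `X1.ParitySqueeze.AnalyticLambdaEq W₀ p n` is well defined, and given the μ-part the stub
# at a pair IS Mazur's main conjecture at the pair (helper file; closes nothing)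

Seat `bsd-eis-lam-a` (PROGRAMME PART 1b, ACCEL-LIST (4), "X1 and X2 versions"); skeleton owner
bsd-eis-ky (`Lines/mudescent.lean` on -19035, sha d113fc0a…). X2 twins (crux 3, -19033):
`EisensteinPrimesAnalyticLambdaCalculus`, `EisensteinPrimesAnalyticLambdaCruxSized`.

HONEST FRAMING. Nothing here proves a main conjecture or moves a label; theorems only, no named
fact. The registered X1 stub reads `ClassX1 W₀ p → W₀.analyticRank = 0 → ¬HasRamifiedOddLineAt W₀ p →
∃ n k, X1.ParitySqueeze.AnalyticLambdaEq W₀ p n ∧ X1.TamagawaSqueeze.AlgebraicLambdaGE W₀ p k ∧ n ≤ k`.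

* §1 `exists_analyticLambdaEq` — `∃ n, X1.ParitySqueeze.AnalyticLambdaEq W p n` for EVERY `(W, p)`,
  UNCONDITIONALLY: the newform at the conductor level is unique (`IsNewformOf.unique`), `ϖ` is pinned
  by `Ω(W) ≠ 0`, `L_p(f, α)` is a function of `f`, `ι` is injective — so all admissible `g` coincide
  and `n := λ(g)` (vacuous if no integral `g` exists). `analyticLambdaEq_unique`: single-valued.
* §1b `analyticLambdaEq_of_isIsogenous` — the X1 analytic conjunct TRANSPORTS along a ℚ-isogeny at a
  good prime (given integrality of `ϖ·L_p` at the source, e.g. Wuthrich 2014 Thm. 16, and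
  modularity): newform, level (`IsNewformOf.level_eq_level`, by generalising the level) and unit
  root (`frobeniusTrace_eq_of_isIsogenous`) are shared, and `λ` is blind to the rational period
  ratio (`lam_eq_of_proportional`). With lam-b's H1 (`algebraicLambdaGE_of_isIsogenous`) BOTH
  conjuncts of the X1 stub are class statements.
* §2 `exists_lambdaCount_of_mazurMainConjecture` — at a good ordinary `p`, `MazurMainConjecture W p`
  (tree `Rank1ResidualX1Defs`) IMPLIES the stub's conclusion at `(W, p)` with `n = k = λ(g)`, `g` a
  characteristic generator at the normalised cyclotomic datum (modularity `hpar` supplies the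
  datum; `g ≠ 0` by Rohrlich, tree `mul_ne_zero_of_iota_eq`; the algebraic conjunct at every
  `(κ₁, γ₁, D₁)` by `lambdaInvariant_eq_of_kerSubgroup_eq` of the X2 file 2/2 and the structure
  theorem `lam_generator_eq_lambdaInvariant`).
* §3 `lambdaCount_iff_mazurMainConjecture` — with the skeleton's route T
  (`X1.TamagawaSqueeze.mazurMainConjecture_of_algebraicLambdaGE`, granted Wuthrich 2014 Thm. 16 and
  the μ-part `MuPartAt W p`, which stub 3 supplies via `X1.MuPart.muPartAt_of_analyticMuLE_zero`):
  AT A PAIR WITH THE μ-PART, STUB 4 ⟺ `MazurMainConjecture W p` — crux-sized, as for crux 3.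

WHAT THIS SAYS (numbers, not adjectives): the analytic conjunct carries no construction; the content
of the X1 stub is the one inequality `λ(X(W₀/ℚ_∞)) ≥ λ_an(W₀, p)`, the `λ`-half of Mazur's main
conjecture at an anomalous type-A Eisenstein prime, for which print holds exactly one ¬GVPar
instance: Pollack–Wake 2025 Thm. 5.12 (prime level `N ≡ 1 (mod p)`, `p ≥ 5` not a `p`-th power mod
`N`: `λ = 0` along the Hida family of `1 ⊕ ω`; elliptic-curve content = the conductor-11 class at
`p = 5`, where `λ_alg = λ_an = 0` is Greenberg LNM 1716 pp. 124–127), and the GV-shape count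
`λ_φ + λ_ψ + Σδ` is false at that very pair (lam-b MEMO-1 §4: count 1).

References: [GreenbergVatsal2000] (1)–(2), p. 4, p. 5; [Wuthrich2014] Thm. 16;
[RohrlichInventiones1984] Theorem (p. 409); [PollackWake2025] Thm. 5.12; [GreenbergLNM1716] §5
(conductor 11); HOME/lam-b-MEMO-1.md §4.
-/

set_option linter.dupNamespace false
set_option autoImplicit false

noncomputable section

open scoped Classical MatrixGroups ModularForm

open PowerSeries CongruenceSubgroup WeierstrassCurve Literature.NumberTheory.EllipticCurves
  Literature.NumberTheory.EllipticCurves.ModularForms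
  Literature.NumberTheory.EllipticCurves.Rank1Residual
  Summit.BirchSwinnertonDyer.BirchSwinnertonDyer.Theorems.Rank1ResidualX1Defs
  Summit.BirchSwinnertonDyer.Rank1Residual
  Summit.BirchSwinnertonDyer.Rank1Residual.X1.MuLambda
  Summit.BirchSwinnertonDyer.Rank1Residual.X1.ParitySqueeze
  Summit.BirchSwinnertonDyer.Rank1Residual.X1.TamagawaSqueeze
  Summit.BirchSwinnertonDyer.BirchSwinnertonDyer.Theorems.EisensteinPrimesAnalyticLambdaCruxSized

namespace Summit.BirchSwinnertonDyer.BirchSwinnertonDyer.Theorems.EisensteinPrimesX1AnalyticLambdaCalculus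

variable {W : WeierstrassCurve ℚ} [W.IsElliptic] [W.IsGloballyMinimal] {p : ℕ} [Fact p.Prime]

/-! ## §1. The X1 analytic conjunct is inhabited and single-valued -/

omit [W.IsElliptic] in
/-- **Two admissible X1 data have the same `g`.** At the conductor level the newform of `W` is
unique (`IsNewformOf.unique`), `ϖ` is pinned by `ϖ·Ω(W) = Ω⁺_f` with `Ω⁺_f > 0`, and `ι` is injective:
`ι g = ϖ·L_p(f,α)`, `ι g' = ϖ'·L_p(f',α)` force `g = g'`. [folklore] -/
theorem eq_of_data [NeZero (W.conductorNorm ℤ)] {f f' : CuspForm (Gamma0 (W.conductorNorm ℤ)) 2}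
    (hf : IsNewformOf W f) (hf' : IsNewformOf W f') {ϖ ϖ' : ℚ}
    (hϖ : (ϖ : ℝ) * W.realPeriodRat = plusPeriod f) (hϖ' : (ϖ' : ℝ) * W.realPeriodRat = plusPeriod f')
    {g g' : IwasawaAlgebra p}
    (hg : iwasawaToPowerSeries p g = C (ϖ : ℚ_[p]) * padicLFunction f (unitRoot W p : ℚ_[p]))
    (hg' : iwasawaToPowerSeries p g' = C (ϖ' : ℚ_[p]) * padicLFunction f' (unitRoot W p : ℚ_[p])) :
    g = g' := by
  obtain rfl : f = f' := hf.unique hf'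
  obtain ⟨-, hΩ⟩ := EisensteinPrimesAnalyticLambdaCalculus.varpi_ne_zero_and_realPeriodRat_ne_zero hf hϖ
  have hϖϖ : ϖ = ϖ' := by
    have h : (ϖ : ℝ) * W.realPeriodRat = (ϖ' : ℝ) * W.realPeriodRat := by rw [hϖ, hϖ']
    exact_mod_cast mul_right_cancel₀ hΩ h
  subst hϖϖ
  exact iwasawaToPowerSeries_injective p (hg.trans hg'.symm)

/-- **The typed X1 analytic `λ` is well defined: `∃ n, X1.ParitySqueeze.AnalyticLambdaEq W p n` for
EVERY globally minimal elliptic `W/ℚ` and prime `p`** (UNCONDITIONAL; `n := λ(g)` of any admissible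
integral `g`, all of which coincide by `eq_of_data`; vacuous if none exists). So the analytic
conjunct of the X1 stub carries no construction. [cite: GreenbergVatsal2000, (1)–(2)] -/
theorem exists_analyticLambdaEq : ∃ n : ℕ, X1.ParitySqueeze.AnalyticLambdaEq W p n := by
  by_cases h : ∃ (_ : NeZero (W.conductorNorm ℤ)) (f : CuspForm (Gamma0 (W.conductorNorm ℤ)) 2)
      (ϖ : ℚ) (g : IwasawaAlgebra p), IsNewformOf W f ∧ (ϖ : ℝ) * W.realPeriodRat = plusPeriod f ∧
      iwasawaToPowerSeries p g = C (ϖ : ℚ_[p]) * padicLFunction f (unitRoot W p : ℚ_[p])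
  · obtain ⟨_, f, ϖ, g, hf, hϖ, hg⟩ := h
    refine ⟨lam g, ?_⟩
    intro _ f' hf' ϖ' hϖ' g' hg'
    rw [← eq_of_data hf hf' hϖ hϖ' hg hg']
  · refine ⟨0, ?_⟩
    intro _ f' hf' ϖ' hϖ' g' hg'
    exact absurd ⟨inferInstance, f', ϖ', g', hf', hϖ', hg'⟩ h

/-- **Single-valuedness of the X1 analytic `λ`**: two values `n, m` with one admissible integral
datum coincide. [folklore] -/
theorem analyticLambdaEq_unique {n m : ℕ} (hn : X1.ParitySqueeze.AnalyticLambdaEq W p n)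
    (hm : X1.ParitySqueeze.AnalyticLambdaEq W p m) [NeZero (W.conductorNorm ℤ)]
    {f : CuspForm (Gamma0 (W.conductorNorm ℤ)) 2} (hf : IsNewformOf W f) {ϖ : ℚ}
    (hϖ : (ϖ : ℝ) * W.realPeriodRat = plusPeriod f) {g : IwasawaAlgebra p}
    (hg : iwasawaToPowerSeries p g = C (ϖ : ℚ_[p]) * padicLFunction f (unitRoot W p : ℚ_[p])) :
    n = m :=
  (hn f hf ϖ hϖ g hg).symm.trans (hm f hf ϖ hϖ g hg)


/-! ## §1b. The X1 analytic conjunct is a ℚ-isogeny-class statement -/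

omit [W.IsElliptic] [W.IsGloballyMinimal] in
/-- **`λ` of two integral lifts of proportional series agree**: if `ι g = a·L` and `ι g' = a'·L`
with `a, a' ∈ ℚˣ`, then `λ(g) = λ(g')` — whichever of `a'/a`, `a/a'` is `p`-integral exhibits one of
`g, g'` as a nonzero `ℤ_p`-constant multiple of the other inside `Λ` (`ι` injective), and `λ` is
blind to such constants (`lam_C_mul`). [folklore] -/
theorem lam_eq_of_proportional {a a' : ℚ} (ha : a ≠ 0) (ha' : a' ≠ 0) {L : PowerSeries ℚ_[p]}
    {g g' : IwasawaAlgebra p} (hg : iwasawaToPowerSeries p g = C (a : ℚ_[p]) * L)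
    (hg' : iwasawaToPowerSeries p g' = C (a' : ℚ_[p]) * L) : lam g = lam g' := by
  have hι := iwasawaToPowerSeries_injective p
  set r : ℚ := a' / a with hr
  have hr0 : r ≠ 0 := div_ne_zero ha' ha
  have hrel : C (a' : ℚ_[p]) * L = C (r : ℚ_[p]) * (C (a : ℚ_[p]) * L) := by
    rw [← mul_assoc, ← map_mul]
    congr 2
    have : (a' : ℚ_[p]) = ((r * a : ℚ) : ℚ_[p]) := by rw [hr, div_mul_cancel₀ _ ha]
    rw [this]; push_cast; ring
  by_cases hg0 : g = 0
  · have hL0 : L = 0 := by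
      have h0 : C (a : ℚ_[p]) * L = 0 := by rw [← hg, hg0, map_zero]
      rcases mul_eq_zero.mp h0 with hC | hL
      · exfalso
        have h1 := congrArg PowerSeries.constantCoeff hC
        rw [PowerSeries.constantCoeff_C, map_zero] at h1
        exact ha (by exact_mod_cast h1)
      · exact hL
    have hg'0 : g' = 0 := hι (by rw [hg', hL0, mul_zero, map_zero])
    rw [hg0, hg'0]
  · rcases le_or_gt ‖(r : ℚ_[p])‖ 1 with hle | hgt
    · set c : ℤ_[p] := ⟨(r : ℚ_[p]), hle⟩ with hc
      have hc0 : c ≠ 0 := by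
        intro h
        have : (r : ℚ_[p]) = 0 := by
          have := congrArg (Subtype.val) h
          simpa [hc] using this
        exact hr0 (by exact_mod_cast this)
      have hGG : g' = PowerSeries.C c * g := by
        apply hι
        rw [EisensteinPrimesAnalyticLambdaCalculus.iwasawaToPowerSeries_C_mul, hg', hrel, hg]
      rw [hGG, EisensteinPrimesAnalyticLambdaCalculus.lam_C_mul hc0 hg0]
    · have hle' : ‖((r⁻¹ : ℚ) : ℚ_[p])‖ ≤ 1 := by
        push_cast
        rw [norm_inv]
        exact inv_le_one_of_one_le₀ hgt.le
      set c : ℤ_[p] := ⟨((r⁻¹ : ℚ) : ℚ_[p]), hle'⟩ with hc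
      have hc0 : c ≠ 0 := by
        intro h
        have : ((r⁻¹ : ℚ) : ℚ_[p]) = 0 := by
          have := congrArg (Subtype.val) h
          simpa [hc] using this
        exact (inv_ne_zero hr0) (by exact_mod_cast this)
      have hrQ0 : (r : ℚ_[p]) ≠ 0 := by exact_mod_cast hr0
      have hGG : g = PowerSeries.C c * g' := by
        apply hι
        rw [EisensteinPrimesAnalyticLambdaCalculus.iwasawaToPowerSeries_C_mul, hg', hrel, hg, ← mul_assoc,
          ← map_mul]
        have : (c : ℚ_[p]) * (r : ℚ_[p]) = 1 := by
          rw [hc]; push_cast; exact inv_mul_cancel₀ hrQ0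
        rw [this, map_one, one_mul]
      have hg'0 : g' ≠ 0 := by
        intro h; apply hg0; rw [hGG, h, mul_zero]
      rw [hGG, EisensteinPrimesAnalyticLambdaCalculus.lam_C_mul hc0 hg'0]

/-- **The X1 analytic conjunct transports along a ℚ-isogeny** (good reduction at `p`). Let
`W ∼ W'` be isogenous globally minimal elliptic curves with good reduction at `p`, and suppose the
Néron-normalised `p`-adic `L`-function is integral at `W` (`hint`: some `g ∈ Λ` with
`ι g = ϖ·L_p(f,α)` for the newform and `ϖ` of `W`; at a reducible good ordinary `p` this is
Wuthrich 2014 Thm. 16). Then `X1.AnalyticLambdaEq W p n → X1.AnalyticLambdaEq W' p n`. Inputs (tree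
theorems): the newform of `W'` is a newform of `W` (`IsNewformOf.of_isIsogenous`) hence lives at
the same level (`IsNewformOf.level_eq_level`, used through a generalisation of the level) and IS
the newform of `W` (`IsNewformOf.unique`); `a_p(W) = a_p(W')` (`frobeniusTrace_eq_of_isIsogenous`)
so `unitRoot W p = unitRoot W' p`; modularity (`hpar`) supplies `ϖ` for `W`; `lam_eq_of_proportional`.
[cite: GreenbergVatsal2000, p. 28] [cite: AtkinLehner1970, Thm. 4] -/
theorem analyticLambdaEq_of_isIsogenous {W' : WeierstrassCurve ℚ} [W'.IsElliptic]
    [W'.IsGloballyMinimal] (hpar : nonempty_modularParametrizationData) (hiso : IsIsogenous W W')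
    (hgood : W.HasGoodReductionAtPrime p) (hgood' : W'.HasGoodReductionAtPrime p)
    (hint : ∀ [NeZero (W.conductorNorm ℤ)] (f : CuspForm (Gamma0 (W.conductorNorm ℤ)) 2),
      IsNewformOf W f → ∀ ϖ : ℚ, (ϖ : ℝ) * W.realPeriodRat = plusPeriod f →
      ∃ g : IwasawaAlgebra p,
        iwasawaToPowerSeries p g = C (ϖ : ℚ_[p]) * padicLFunction f (unitRoot W p : ℚ_[p]))
    {n : ℕ} (hn : X1.ParitySqueeze.AnalyticLambdaEq W p n) :
    X1.ParitySqueeze.AnalyticLambdaEq W' p n := by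
  intro _ f' hf' ϖ' hϖ' g' hg'
  haveI hN : NeZero (W.conductorNorm ℤ) := ⟨(W.conductorNorm_pos_holds).ne'⟩
  obtain ⟨Dm⟩ := hpar W
  have hf : IsNewformOf W Dm.f := Dm.isNewformOf
  obtain ⟨ϖ, -, hϖ, -⟩ := Dm.exists_rat_mul_realPeriodRat_eq_plusPeriod
  have hϖ0 : ϖ ≠ 0 := varpi_ne_zero hf hϖ
  have hf'W : IsNewformOf W f' := hf'.of_isIsogenous hiso
  -- `α(W') = α(W)`
  have hα : unitRoot W' p = unitRoot W p := by
    have htr : W'.frobeniusTrace p = W.frobeniusTrace p :=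
      (frobeniusTrace_eq_of_isIsogenous hiso p hgood hgood').symm
    simp only [unitRoot, htr]
  rw [hα] at hg'
  -- everything at the level of `W'`, generalised to a level `M = N_W`
  have key : ∀ (M : ℕ) (_ : M = W.conductorNorm ℤ) [NeZero M] (f₁ : CuspForm (Gamma0 M) 2),
      IsNewformOf W f₁ → ∀ (ϖ₁ : ℚ), (ϖ₁ : ℝ) * W'.realPeriodRat = plusPeriod f₁ →
      ∀ g₁ : IwasawaAlgebra p,
        iwasawaToPowerSeries p g₁ = C (ϖ₁ : ℚ_[p]) * padicLFunction f₁ (unitRoot W p : ℚ_[p]) →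
        lam g₁ = n := by
    intro M hM
    subst hM
    intro _ f₁ hf₁ ϖ₁ hϖ₁ g₁ hg₁
    obtain rfl : f₁ = Dm.f := hf₁.unique hf
    obtain ⟨g, hg⟩ := hint Dm.f hf ϖ hϖ
    have hlam : lam g = n := hn Dm.f hf ϖ hϖ g hg
    have hϖ₁0 : ϖ₁ ≠ 0 := by
      rintro rfl
      have hper : 0 < plusPeriod Dm.f :=
        IsNewform0.plusPeriod_pos_holds hf.1 hf.coeffField_eq_bot
      rw [← hϖ₁, Rat.cast_zero, zero_mul] at hper
      exact lt_irrefl _ hper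
    rw [← hlam]
    exact (lam_eq_of_proportional hϖ0 hϖ₁0 hg hg₁).symm
  exact key (W'.conductorNorm ℤ) (hf'W.level_eq_level hf) f' hf'W ϖ' hϖ' g' hg'

/-! ## §2. Given the datum, the X1 stub's conclusion FOLLOWS FROM Mazur's main conjecture -/

/-- **Mazur's main conjecture at a good ordinary `(W, p)` implies the conclusion of the X1
`stub_lambdaCount_offLocus` at `(W, p)`** with `n = k = λ(g)`, `g` a characteristic generator at the
normalised cyclotomic datum (`ι g = ϖ·L_p(f,α)`; `g ≠ 0` by Rohrlich); the analytic conjunct by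
`eq_of_data`, the algebraic conjunct at every cyclotomic torsion datum `(κ₁, γ₁, D₁)` by
`lambdaInvariant_eq_of_kerSubgroup_eq` and `lam_generator_eq_lambdaInvariant`. Modularity (`hpar`)
supplies the newform, `ϖ` and the datum. [cite: GreenbergVatsal2000, p. 4 (after Thm. (1.2))]
[cite: RohrlichInventiones1984, Theorem (p. 409)] -/
theorem exists_lambdaCount_of_mazurMainConjecture (hpar : nonempty_modularParametrizationData)
    (hgood : W.HasGoodReductionAtPrime p) (hord : ¬ (p : ℤ) ∣ W.frobeniusTrace p)
    (hMC : MazurMainConjecture W p) :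
    ∃ n k : ℕ, X1.ParitySqueeze.AnalyticLambdaEq W p n ∧ AlgebraicLambdaGE W p k ∧ n ≤ k := by
  haveI : NeZero (W.conductorNorm ℤ) := ⟨(W.conductorNorm_pos_holds).ne'⟩
  obtain ⟨Dm⟩ := hpar W
  have hf : IsNewformOf W Dm.f := Dm.isNewformOf
  obtain ⟨ϖ, -, hϖ, -⟩ := Dm.exists_rat_mul_realPeriodRat_eq_plusPeriod
  obtain ⟨κ, hκ, γ, hγ, hγ'⟩ := exists_isCyclotomic_isTopGenerator_isCyclotomicVariable_holds p
  obtain ⟨D⟩ := W.nonempty_selmerDualData_holds κ γ hγ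
  haveI : Module.Finite (IwasawaAlgebra p) D.X := D.module_finite_holds hγ
  obtain ⟨hXt, g, hchar, hg⟩ := hMC κ γ hκ hγ hγ' Dm.f hf ϖ hϖ D
  have hg1 : iwasawaToPowerSeries p (g * 1) =
      C (ϖ : ℚ_[p]) * padicLFunction Dm.f (unitRoot W p : ℚ_[p]) := by rw [mul_one]; exact hg
  have hg0 : g ≠ 0 := fun h0 ↦ mul_ne_zero_of_iota_eq hgood hord hf hϖ D hg1 (by rw [h0, zero_mul])
  refine ⟨lam g, lam g, ?_, ?_, le_rfl⟩
  · intro _ f' hf' ϖ' hϖ' g' hg'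
    rw [← eq_of_data hf hf' hϖ hϖ' hg hg']
  · intro κ₁ γ₁ hκ₁ _ D₁ _ _
    have hker : κ.kerSubgroup = κ₁.kerSubgroup := hκ.trans hκ₁.symm
    rw [← lambdaInvariant_eq_of_kerSubgroup_eq D D₁ hker, ← lam_generator_eq_lambdaInvariant D.X hXt hg0 hchar]

/-! ## §3. At a pair with the μ-part, the X1 stub IS Mazur's main conjecture -/

/-- **X1 stub 4 of `mudescent` at a pair with the μ-part IS Mazur's main conjecture at that pair.**
`W/ℚ` globally minimal, `p ≠ 2` good ordinary with `E[p]` reducible; granted Wuthrich 2014 Thm. 16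
(`hW16`), modularity (`hpar`) and the μ-part `MuPartAt W p` (stub 3 of the line via
`X1.MuPart.muPartAt_of_analyticMuLE_zero`): `(∃ n k, X1.AnalyticLambdaEq W p n ∧ AlgebraicLambdaGE W p k
∧ n ≤ k) ↔ MazurMainConjecture W p` (`→`: the tree's route T
`X1.TamagawaSqueeze.mazurMainConjecture_of_algebraicLambdaGE`; `←`: §2). Read at the étale end `W₀`
of `MazurMCOnX1RankZero_of`: modulo stub 3 the stub is the crux at the located pair (and, by the
tree's rank-`0` isogeny invariance `Rank1ResidualX1Isogeny.mazurMainConjecture_iff_of_isIsogenous_of_analyticRank_eq_zero`,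
at the displayed pair) — CRUX-SIZED. [cite: Wuthrich2014, Thm. 16 (p. 397)]
[cite: GreenbergVatsal2000, p. 4 (after Thm. (1.2)) and p. 5] -/
theorem lambdaCount_iff_mazurMainConjecture (hW16 : Wuthrich2014.charIdeal_dvd_padicLFunction)
    (hpar : nonempty_modularParametrizationData) (hp : p ≠ 2)
    (hgood : W.HasGoodReductionAtPrime p) (hord : ¬ (p : ℤ) ∣ W.frobeniusTrace p)
    (hred : ¬ W.HasIrreducibleModPGaloisRep p) (hμ : MuPartAt W p) :
    (∃ n k : ℕ, X1.ParitySqueeze.AnalyticLambdaEq W p n ∧ AlgebraicLambdaGE W p k ∧ n ≤ k) ↔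
      MazurMainConjecture W p :=
  ⟨fun ⟨_, _, hlam, hk, hnk⟩ ↦
      X1.TamagawaSqueeze.mazurMainConjecture_of_algebraicLambdaGE hW16 hp hgood hord hred hμ hlam hk hnk,
    fun hMC ↦ exists_lambdaCount_of_mazurMainConjecture hpar hgood hord hMC⟩

end Summit.BirchSwinnertonDyer.BirchSwinnertonDyer.Theorems.EisensteinPrimesX1AnalyticLambdaCalculus

end
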